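import Summits.FinalStateConjecture.FinalStateConjecture.Theorems.SwallowTheDatumParametricKerrBurialStubEndRescaling
import Summits.FinalStateConjecture.FinalStateConjecture.Theorems.SwallowTheDatumParametricKerrBurialStubFarGluingOfUnitGluingAux

/-!
# `ParametricKerrBurial`, line `receding-annulus-universal-collar` — stub
# `stub_farGluing_of_unitGluing` (A2b) (crux item stmt-FinalStateConjecture-10052)

The registered stub `stub_farGluing_of_unitGluing`, proved: the bookkeeping half of the far
gluing. Inputs: an admissible datum `d` on `X` with sole end `e`, radii `R > R⋆ ≥ 1`,
`R⋆ > e.R`, and two families of data on `ℝ³` — the rescaled chart data `I R` of `d`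
(`coordH (I R) y = hCoeff e d (R y)`, `coordK (I R) y = R kCoeff e d (R y)` on `{1/2 < ‖y‖}`, the
landed stub A2a) and the unit-scale outputs `O R` of the annular gluing (the atom A1: jointly
smooth on `{R⋆ < R} × {1 < ‖y‖}`, vacuum on `{1 < ‖y‖}`, `= I R` on `{1 < ‖y‖ < 2}`, exactly
isotropic Schwarzschild(`η`) beyond radius `32`). Output: `m R := η R` and

  `G R := d` inside / `coord^*((O R).dilate R)` beyond chart radius `5R/4`

(`AFEnd.patch` with the patch data `farPatchData` of the helper file
`SwallowTheDatumParametricKerrBurialStubFarGluingOfUnitGluingAux.lean`: on the shell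
`{5R/4 < ‖z‖ < 7R/4}` the dilate reads `h_{O R}(z/R) = h_{I R}(z/R) = hCoeff e d (z)` and
`R⁻¹ k_{O R}(z/R) = R⁻¹ k_{I R}(z/R) = kCoeff e d (z)`). Then

* `G R = d` off `e.far R ⊇ e.far (5R/4)` (`patch_eq_of_not_mem_far`);
* `G R` is exactly isotropic Schwarzschild(`ηR`), `k = 0`, beyond chart radius `32R`: its chart
  reading beyond `5R/4` is the dilate (`hCoeff_patch_eq`), which is exactly isotropic
  Schwarzschild(`Rη`) beyond `32R` (`isIsotropicBeyond_dilate`);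
* `G R` is admissible (`patch_mem_admissibleVacuumData_of_vacuumOn`): the dilate is vacuum on
  `{5R/4 < ‖z‖}` (`vacuumOn_dilate`, Bartnik–Isenberg 2004, §2) and its exact isotropic end is a
  sole Dafermos–Rodnianski end (`exists_end_of_isIsotropicBeyond`);
* joint smoothness on `{R⋆ < R}` (`smoothSectionsOn_of_farPatchFamily`): near `(R, x)` with `x`
  inside, `G = d` on a product neighbourhood; with `x` far out, `G` is the outer family of the
  smooth matrix-valued map `(R', z) ↦ h_{O R'}(z/R')` (`contMDiffOn_rescaledFamily`,
  `contMDiffAt_outerField_family`).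

References: Corvino 2000, §4 (insert the exterior solution at the end); Bartnik 1986, §1;
Bartnik–Isenberg 2004, §2; Dafermos–Rodnianski 2013, App. B.2.3; Christodoulou 1999, p. A24.
-/

-- the doubled `FinalStateConjecture` path component is the summit/problem naming scheme, not a mistake
set_option linter.dupNamespace false
-- instance search through the nested operator type `E3 →L[ℝ] E3 →L[ℝ] ℝ` (as in the tree files)
set_option maxSynthPendingDepth 3

noncomputable section

namespace Summit.FinalStateConjecture.FinalStateConjecture.Theorems.SwallowTheDatum.ParametricKerrBurial

open scoped Manifold ContDiff Topology
-- NB: no `open Bundle` (instance synthesis time-outs downstream); `Bundle.TotalSpace.mk'` is qualified.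
open Set Filter Function Metric Literature.Geometry.Lorentzian Literature.Geometry.Manifold

variable {X : Type} [TopologicalSpace X] [ChartedSpace E3 X] [IsManifold (𝓡 3) ∞ X]

/-! ## §1 Joint smoothness of receding far-patch families -/

/-- **Joint smoothness of a receding far-patch family.** Let `secP (R, x)` be a family of
bilinear forms on `T_x X`, `R > R⋆ ≥ 1 > 0`, `R⋆ > e.R`, which on `e.far (5R/4)` is the outer
field `coord^*(fld R)` of a matrix-valued map `fld` jointly smooth on `{R⋆ < R} × {R < ‖z‖}`, and
which off `e.closedFar (7R/4)` is a fixed smooth section `secD`. Then `(R, x) ↦ secP (R, x)` is a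
jointly smooth section on `{R⋆ < R} × X`: near `(R, x)` with `‖coord x‖ ≥ 3R/2` it is the outer
family on the product neighbourhood `{|R' − R| < R/8} × e.far (45R/32)`
(`contMDiffAt_outerField_family`), and near `(R, x)` with `x ∉ e.closedFar (3R/2)` it is `secD`
on `{|R' − R| < R/8} × (e.closedFar (3R/2))ᶜ`. [cite: Corvino2000, §4] -/
theorem smoothSectionsOn_of_farPatchFamily {e : AFEnd X} {Rstar : ℝ} (heR : e.R < Rstar)
    (h1 : 1 ≤ Rstar)
    (secP : Π q : ℝ × X, TangentSpace (𝓡 3) q.2 →L[ℝ] TangentSpace (𝓡 3) q.2 →L[ℝ] ℝ)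
    (secD : Π x : X, TangentSpace (𝓡 3) x →L[ℝ] TangentSpace (𝓡 3) x →L[ℝ] ℝ)
    (fld : ℝ → E3 → E3 →L[ℝ] E3 →L[ℝ] ℝ)
    (hsecD : ContMDiff (𝓡 3) ((𝓡 3).prod 𝓘(ℝ, E3 →L[ℝ] E3 →L[ℝ] ℝ)) ∞
      (fun x : X ↦ Bundle.TotalSpace.mk' (E3 →L[ℝ] E3 →L[ℝ] ℝ)
        (E := fun x : X ↦ TangentSpace (𝓡 3) x →L[ℝ] TangentSpace (𝓡 3) x →L[ℝ] ℝ) x (secD x)))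
    (hfld : ContMDiffOn (𝓘(ℝ, ℝ).prod 𝓘(ℝ, E3)) 𝓘(ℝ, E3 →L[ℝ] E3 →L[ℝ] ℝ) ∞
      (fun p : ℝ × E3 ↦ fld p.1 p.2) {p : ℝ × E3 | Rstar < p.1 ∧ p.1 < ‖p.2‖})
    (hfar : ∀ q : ℝ × X, Rstar < q.1 → q.2 ∈ e.far (5 / 4 * q.1) →
      secP q = AFEnd.outerField e (fld q.1) q.2)
    (hin : ∀ q : ℝ × X, Rstar < q.1 → q.2 ∉ e.closedFar (7 / 4 * q.1) → secP q = secD q.2) :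
    ContMDiffOn (𝓘(ℝ, ℝ).prod (𝓡 3)) ((𝓡 3).prod 𝓘(ℝ, E3 →L[ℝ] E3 →L[ℝ] ℝ)) ∞
      (fun q : ℝ × X ↦ Bundle.TotalSpace.mk' (E3 →L[ℝ] E3 →L[ℝ] ℝ)
        (E := fun x : X ↦ TangentSpace (𝓡 3) x →L[ℝ] TangentSpace (𝓡 3) x →L[ℝ] ℝ) q.2 (secP q))
      {p : ℝ × X | Rstar < p.1} := by
  rintro ⟨R, x⟩ hq
  have hR : Rstar < R := hq
  have hR0 : 0 < R := by linarith
  apply ContMDiffAt.contMDiffWithinAt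
  -- a neighbourhood of `R` on which the radius moves by less than `R/8`
  set N : Set ℝ := ball R (R / 8) ∩ Ioi Rstar with hN
  have hNopen : IsOpen N := isOpen_ball.inter isOpen_Ioi
  have hRN : R ∈ N := ⟨mem_ball_self (by linarith), hR⟩
  have hNl : ∀ R' ∈ N, |R' - R| < R / 8 := fun R' hR' ↦ by
    have h := hR'.1
    rwa [mem_ball, Real.dist_eq] at h
  by_cases hx : x ∈ e.closedFar (3 / 2 * R)
  · -- far out: the outer family on `N × far (45R/32)`
    obtain ⟨hxU, hxρ⟩ := hx
    have hxfar : x ∈ e.far (45 / 32 * R) := e.mem_far_iff_coord.2 ⟨hxU, by linarith⟩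
    have hopen : IsOpen {p : ℝ × E3 | Rstar < p.1 ∧ p.1 < ‖p.2‖} :=
      (isOpen_lt continuous_const continuous_fst).inter
        (isOpen_lt continuous_fst (continuous_norm.comp continuous_snd))
    have hc : ContMDiffAt (𝓘(ℝ, ℝ).prod 𝓘(ℝ, E3)) 𝓘(ℝ, E3 →L[ℝ] E3 →L[ℝ] ℝ) ∞ (uncurry fld)
        (R, e.coord x) :=
      hfld.contMDiffAt (hopen.mem_nhds ⟨hR, show R < ‖e.coord x‖ by linarith⟩)
    have hsm := e.contMDiffAt_outerField_family (IP := 𝓘(ℝ, ℝ)) (c := fld) hxU hc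
    refine hsm.congr_of_eventuallyEq ?_
    have hev : ∀ᶠ q : ℝ × X in 𝓝 (R, x), q.1 ∈ N ∧ q.2 ∈ e.far (45 / 32 * R) :=
      prod_mem_nhds (hNopen.mem_nhds hRN) ((e.isOpen_far _).mem_nhds hxfar)
    filter_upwards [hev] with q hq
    have hq1 : Rstar < q.1 := hq.1.2
    have hql := abs_lt.1 (hNl q.1 hq.1)
    have hq2 : q.2 ∈ e.far (5 / 4 * q.1) := e.far_mono (by linarith [hql.2]) hq.2
    rw [hfar q hq1 hq2]
  · -- inside: the fixed section `secD` on `N × (closedFar (3R/2))ᶜ`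
    have hρ'R : e.R < 3 / 2 * R := by linarith
    have hDat : ContMDiffAt (𝓘(ℝ, ℝ).prod (𝓡 3)) ((𝓡 3).prod 𝓘(ℝ, E3 →L[ℝ] E3 →L[ℝ] ℝ)) ∞
        (fun q : ℝ × X ↦ Bundle.TotalSpace.mk' (E3 →L[ℝ] E3 →L[ℝ] ℝ)
          (E := fun x : X ↦ TangentSpace (𝓡 3) x →L[ℝ] TangentSpace (𝓡 3) x →L[ℝ] ℝ) q.2
          (secD q.2)) (R, x) :=
      (hsecD x).comp (R, x) contMDiffAt_snd
    refine hDat.congr_of_eventuallyEq ?_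
    have hev : ∀ᶠ q : ℝ × X in 𝓝 (R, x), q.1 ∈ N ∧ q.2 ∉ e.closedFar (3 / 2 * R) :=
      prod_mem_nhds (hNopen.mem_nhds hRN) ((e.isClosed_closedFar hρ'R).isOpen_compl.mem_nhds hx)
    filter_upwards [hev] with q hq
    have hq1 : Rstar < q.1 := hq.1.2
    have hql := abs_lt.1 (hNl q.1 hq.1)
    have hq2 : q.2 ∉ e.closedFar (7 / 4 * q.1) := by
      rintro ⟨hU, hle⟩
      exact hq.2 ⟨hU, by linarith [hql.1]⟩
    rw [hin q hq1 hq2]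

/-! ## §2 The stub -/

/-- **Stub `stub_farGluing_of_unitGluing`** (registered signature, line
`receding-annulus-universal-collar`, crux item stmt-FinalStateConjecture-10052). Dilate the
unit-scale outputs `O R` by `R`, transport them along the chart of the end and patch them to `d`
across the shell `{5R/4 < ‖coord‖ < 7R/4}` (agreement there because `O R = I R` on `{1 < ‖y‖ < 2}`
and `I R` IS the rescaled chart data of `d`); `m R := η R`. The patched family is admissible
(vacuum by locality; sole end and Dafermos–Rodnianski decay from the transplanted exact isotropic
Schwarzschild(`ηR`) end of the dilate; complete by `isComplete_of_isSoleEnd_holds`), `= d` off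
`e.far R`, exactly isotropic Schwarzschild(`ηR`), `k = 0`, beyond chart radius `32R`, and jointly
smooth in `(R, x)` on `{R⋆ < R}`. Corvino 2000, §4; Bartnik 1986, §1. [folklore] -/
theorem stub_farGluing_of_unitGluing :
    ∀ (X : Type) [TopologicalSpace X] [ChartedSpace E3 X] [IsManifold (𝓡 3) ∞ X] [T2Space X]
      [SecondCountableTopology X] [ConnectedSpace X] (d : InitialDataSet (𝓡 3) X) (e : AFEnd X)
      (Rstar η : ℝ) (I O : ℝ → InitialDataSet (𝓡 3) E3),
      d ∈ admissibleVacuumData X → e.IsSoleEnd → e.R < Rstar → 1 ≤ Rstar → 0 < η →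
      (∀ R : ℝ, Rstar < R → ∀ y : E3, 1 / 2 < ‖y‖ →
        (I R).coordH y = AFEnd.hCoeff e d (R • y) ∧ (I R).coordK y = R • AFEnd.kCoeff e d (R • y)) →
      SmoothSectionsOn 𝓘(ℝ, ℝ) O {p : ℝ × E3 | Rstar < p.1 ∧ 1 < ‖p.2‖} →
      (∀ R : ℝ, Rstar < R →
        VacuumOn {y | 1 < ‖y‖} (O R) ∧
        (∀ y : E3, 1 < ‖y‖ → ‖y‖ < 2 → (O R).h.inner y = (I R).h.inner y ∧ (O R).k y = (I R).k y) ∧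
        IsIsotropicBeyond η 32 (O R)) →
      ∃ (m : ℝ → ℝ) (G : ℝ → InitialDataSet (𝓡 3) X),
        ContDiff ℝ ∞ m ∧ SmoothSectionsOn 𝓘(ℝ, ℝ) G {p : ℝ × X | Rstar < p.1} ∧
        ∀ R : ℝ, Rstar < R → G R ∈ admissibleVacuumData X ∧ (∀ x ∉ e.far R, AgreeAt (G R) d x) ∧
          η * R ≤ m R ∧ IsExactSchwarzschildBeyond e (G R) (m R) (32 * R) := by
  intro X _ _ _ _ _ _ d e Rstar η I O hd he heR h1 hη hI hOs hO
  classical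
  have hRpos : ∀ {R : ℝ}, Rstar < R → 0 < R := fun hR ↦ by linarith
  have hnorm : ∀ {R : ℝ}, Rstar < R → ∀ y : E3, ‖R⁻¹ • y‖ = R⁻¹ * ‖y‖ := fun hR y ↦ by
    rw [norm_smul, norm_inv, Real.norm_of_nonneg (hRpos hR).le]
  -- the Cartesian components of the dilated outputs `(O R).dilate R`
  have hCH : ∀ {R : ℝ} (h : Rstar < R) (z : E3),
      ((O R).dilate R (hRpos h)).coordH z = (O R).coordH (R⁻¹ • z) := fun h z ↦
    (O _).coordH_dilate _ _ z
  have hCK : ∀ {R : ℝ} (h : Rstar < R) (z : E3),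
      ((O R).dilate R (hRpos h)).coordK z = R⁻¹ • (O R).coordK (R⁻¹ • z) := fun h z ↦
    (O _).coordK_dilate _ _ z
  -- the patch data at each radius: agreement on the shell `{5R/4 < ‖z‖ < 7R/4}`
  have hP : ∀ {R : ℝ} (h : Rstar < R), e.PatchData d (5 / 4 * R) (7 / 4 * R)
      (AFEnd.outerField e ((O R).dilate R (hRpos h)).coordH)
      (AFEnd.outerField e ((O R).dilate R (hRpos h)).coordK) := by
    intro R hR
    have hR0 := hRpos hR
    refine farPatchData (by linarith) (by linarith) fun y hy1 hy2 ↦ ?_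
    have h1' : 1 < ‖R⁻¹ • y‖ := by rw [hnorm hR, lt_inv_mul_iff₀ hR0]; linarith
    have h2' : ‖R⁻¹ • y‖ < 2 := by rw [hnorm hR, inv_mul_lt_iff₀ hR0]; linarith
    obtain ⟨hOI1, hOI2⟩ := (hO R hR).2.1 _ h1' h2'
    obtain ⟨hI1, hI2⟩ := hI R hR _ (by linarith : 1 / 2 < ‖R⁻¹ • y‖)
    rw [smul_inv_smul₀ hR0.ne'] at hI1 hI2
    refine ⟨?_, ?_⟩
    · rw [hCH hR, ← hI1]
      exact hOI1
    · rw [hCK hR, show (O R).coordK (R⁻¹ • y) = (I R).coordK (R⁻¹ • y) from hOI2, hI2,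
        inv_smul_smul₀ hR0.ne']
  -- the family
  let G : ℝ → InitialDataSet (𝓡 3) X := fun R ↦ if h : Rstar < R then e.patch d (hP h) else d
  have hG : ∀ {R : ℝ} (h : Rstar < R), G R = e.patch d (hP h) := fun h ↦ dif_pos h
  -- pointwise values of the sections of `G`
  have hGfar : ∀ {R : ℝ} (h : Rstar < R) {x : X}, x ∈ e.far (5 / 4 * R) →
      (G R).h.inner x = AFEnd.outerField e (fun z ↦ (O R).coordH (R⁻¹ • z)) x ∧
        (G R).k x = AFEnd.outerField e (fun z ↦ R⁻¹ • (O R).coordK (R⁻¹ • z)) x := by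
    intro R h x hx
    rw [hG h]
    exact ⟨(AFEnd.patch_h_inner_of_mem (hP h) hx).trans (e.outerField_congr (hCH h _)),
      (AFEnd.patch_k_of_mem (hP h) hx).trans (e.outerField_congr (hCK h _))⟩
  have hGin : ∀ {R : ℝ} (h : Rstar < R) {x : X}, x ∉ e.closedFar (7 / 4 * R) →
      (G R).h.inner x = d.h.inner x ∧ (G R).k x = d.k x := by
    intro R h x hx
    rw [hG h]
    exact ⟨AFEnd.patch_h_inner_of_not_mem_closedFar (hP h) hx,
      AFEnd.patch_k_of_not_mem_closedFar (hP h) hx⟩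
  refine ⟨fun R ↦ η * R, G, contDiff_const.mul contDiff_id, ?_,
    fun R hR ↦ ⟨?_, fun x hx ↦ ?_, le_rfl, ?_⟩⟩
  · -- joint smoothness on `{R⋆ < R}`
    obtain ⟨hH, hK⟩ := contMDiffOn_rescaledFamily h1 hOs
    exact ⟨smoothSectionsOn_of_farPatchFamily heR h1 (fun q ↦ (G q.1).h.inner q.2) d.h.inner
        (fun R' z ↦ (O R').coordH (R'⁻¹ • z)) d.h.contMDiff hH (fun q hq hx ↦ (hGfar hq hx).1)
        (fun q hq hx ↦ (hGin hq hx).1),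
      smoothSectionsOn_of_farPatchFamily heR h1 (fun q ↦ (G q.1).k q.2) d.k
        (fun R' z ↦ R'⁻¹ • (O R').coordK (R'⁻¹ • z)) d.contMDiff_k hK
        (fun q hq hx ↦ (hGfar hq hx).2) (fun q hq hx ↦ (hGin hq hx).2)⟩
  · -- admissibility: the dilate is vacuum on `{5R/4 < ‖z‖}`; the end of the dilate
    have hR0 := hRpos hR
    have hdvac : ∀ [d.metric.HasLeviCivita], d.IsVacuumConstraintSolution := fun {inst} ↦ (hd.1).1
    have hCvac : VacuumOn {y | 5 / 4 * R < ‖y‖} ((O R).dilate R hR0) := by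
      refine vacuumOn_dilate (O R) (hO R hR).1 hR0 fun y hy ↦ ?_
      show 1 < ‖R⁻¹ • y‖
      rw [hnorm hR, lt_inv_mul_iff₀ hR0, mul_one]
      change 5 / 4 * R < ‖y‖ at hy
      linarith
    obtain ⟨f, hfsole, hfdecay⟩ := exists_end_of_isIsotropicBeyond (mul_nonneg hR0.le hη.le)
      (mul_pos hR0 (by norm_num : (0 : ℝ) < 32))
      (isIsotropicBeyond_dilate (O R) (hO R hR).2.2 hR0 (by norm_num))
    rw [hG hR]
    exact patch_mem_admissibleVacuumData_of_vacuumOn (hP hR) he hdvac hCvac hfsole hfdecay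
  · -- agreement with `d` off `e.far R ⊇ e.far (5R/4)`
    have hx' : x ∉ e.far (5 / 4 * R) := fun h ↦ hx (e.far_mono (by linarith [hRpos hR]) h)
    show (G R).h.inner x = d.h.inner x ∧ (G R).k x = d.k x
    rw [hG hR]
    exact AFEnd.patch_eq_of_not_mem_far (hP hR) hx'
  · -- exact isotropic Schwarzschild(`ηR`) beyond chart radius `32R`
    have hR0 := hRpos hR
    have hiso := isIsotropicBeyond_dilate (O R) (hO R hR).2.2 hR0 (by norm_num : (0 : ℝ) < 32)
    show IsExactSchwarzschildBeyond e (G R) (η * R) (32 * R)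
    rw [hG hR]
    intro z hz
    obtain ⟨hh, hk⟩ := hCoeff_patch_eq (hP hR) (show 5 / 4 * R < ‖z‖ by linarith)
    obtain ⟨h1z, h2z⟩ := hiso z (by linarith : R * 32 < ‖z‖)
    refine ⟨?_, ?_⟩
    · rw [hh, mul_comm η R]
      exact h1z
    · rw [hk]
      exact h2z

end Summit.FinalStateConjecture.FinalStateConjecture.Theorems.SwallowTheDatum.ParametricKerrBurial

end
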